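import Summits.BirchSwinnertonDyer.BirchSwinnertonDyer.Theorems.Rank1ResidualJetThm63RowData
import Summits.BirchSwinnertonDyer.BirchSwinnertonDyer.Theorems.Rank1ResidualJetKolyvaginClassOrder
import Summits.BirchSwinnertonDyer.BirchSwinnertonDyer.Theorems.Rank1ResidualJetCompatibleData
import Summits.BirchSwinnertonDyer.BirchSwinnertonDyer.Theorems.Rank1ResidualJetKolyvaginClassSign
import Summits.BirchSwinnertonDyer.BirchSwinnertonDyer.Theorems.Rank1ResidualJetKolyvaginClassLocal
import Literature.NumberTheory.EllipticCurves.McCallum1991.EigenclassesCebotarevLevelPow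
import HarnessLib

/-!
# T1 JET (cell `bsd-jet`), road K: [J] Thm 5.2 for the row objects WITH THE KERNEL BRICKS PLUGGED IN —
# `t ≤ m_∞` at a core vertex from named print {[McC 4.4], Gross §3 CM, Gross 5.3, [GZ86 III (3.1)]}
# plus the EXACT residual kernel gaps (transverse condition, stringent condition at the carrier,
# the two Poitou–Tate packages)

HONEST FRAMING (programme file §HONESTY, verbatim): «no tranche here proves BSD; ARM L moves the
LITERAL column of an r ≤ 1 census into the kernel-proved-modulo-named-print column.» THEOREMS ONLY
(seat `bsd-jet-pv-2`, session g3; `--supports stmt-BirchSwinnertonDyer-14418`, helper); 0 classes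
move. WHAT THIS IS. `JET.tamagawaExponent_le_mInfty_of_rowData` (p492296) is printed Thm. 5.2 at a core
vertex with NAMED hypotheses. This file feeds it the kernel theorems landed since:
* `h32` ([McC] Cor. 3.2 at level `p^k`) := `McCallum1991.cor32_eigenclasses_infinite_primes_localOrder_holds`
  (p497442, PROVED from Čebotarev + Weil pairing);
* the datum `d` of conductor `c`, `hordκ`, `hκ0` := `exists_datum_addOrderOf_kolyvaginClass_of_m_eq`
  (p495574: `p^{m_∞} ∥ P_c`, `ord c_k(c) = p^{k−m_∞}` from the `H63` binder's `mdiv`/`m`);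
* `dℓ`, `hdata` := `exists_compatible_data_of_grossCM` (p496827: compatible data at `cℓ`);
* `e`, `he`, `hκsign` := `exists_sign_conjAct_kolyvaginClass_of_prop53` (p498178: Gross Prop. 5.4,
  `e = ε·(−1)^{#primes of c}`, modulo Gross Prop. 5.3 `h53`);
* the KUMMER part of `hκsel` := `localization_kolyvaginClass_mem_kummerSelmerStructure_of_GZ31`
  (p498536: Gross Prop. 6.2 (1) at every place not over `c`, modulo [GZ86 III (3.1)] `hGZ`);
* `hS` := any stringent family below the Kummer family (e.g. `JET.stringentFamily`, p492589).
What is LEFT as hypotheses is exactly: the named print inputs {`h44` = [McC] Prop. 4.4 typed fact,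
`hCM1`/`hCM2` = Gross 1991 §3 CM facts, `h53` = Gross 1991 Prop. 5.3 (sign `ε`), `hGZ` = [GZ86 III (3.1)]
receptacle form with `n′` prime to `p`} and the GENUINE KERNEL GAPS of the instantiation layer
(sheet PV2-J6-KERNEL §2: S2/S10 + S1/S3): `htr` (the TRANSVERSE condition of `c_k(c)` at the primes of
`c`, [J] p. 820 *"known to satisfy the local conditions for 𝓕(c) (see [Gross], [McCallum] or
[Howard])"*), `hT` (a local transverse family reconciled with `transverseKer`), `h49str` / `h49tr` (of Prop. 4.9♯ for
the classes at `cℓ` only the STRINGENT condition at the carrier places — Jetchev's Prop. 4.9 proper, the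
x11b3 layer theorem at `v ∣ p` — and the TRANSVERSE condition at the primes of `c` remain; the sign and
Kummer parts are discharged here by the same bricks at level `cℓ`, `mem_signPart_relaxedAt_selmerF0`),
`hdual_q` / `hdual_ℓ` (Thm. 5.1 /
Lemma 5.2 (iii) in counting form: pv-1's `JET.GlobalDuality.relIndex_selmerGroup_mul_relIndex_dualSelmerGroup_minus`
+ the (δ) local index + the Weil self-duality on `H¹`). Nothing else. CONCLUSION `t ≤ m_∞`.
References: [cite: Jetchev2008, Thm. 5.2 (p. 821) and proof (pp. 821–822); Prop. 4.6, Prop. 4.9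
(p. 820)] [cite: McCallumLMS1991, §3 Cor. 3.2, §4 Prop. 4.4, §5 (p. 305)]
[cite: GrossLMS1991, §3, Prop. 3.6, Lemma 4.3, Prop. 5.3, Prop. 5.4, Prop. 6.2 (1)] [cite: GrossZagier1986, III (3.1)].
-/

set_option autoImplicit false

noncomputable section

open scoped Classical

open WeierstrassCurve IsDedekindDomain NumberField Literature.NumberTheory.EllipticCurves
  Literature.NumberTheory.EllipticCurves.ModularForms Literature.NumberTheory.EllipticCurves.Jetchev2008
  Literature.NumberTheory.GaloisRepresentations
  Literature.NumberTheory.GaloisRepresentations.DiscreteGaloisModule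
  Summit.BirchSwinnertonDyer.Rank1Residual.X11b

namespace Summit.BirchSwinnertonDyer.Rank1Residual.JET

section Split

variable {K : Type} [Field K] [NumberField K]

/-- Over an INERT rational prime `ℓ` (`(ℓ)` prime in `𝓞 K`) there is exactly one place of `K`: two
height-one primes containing `ℓ` coincide. [folklore] -/
theorem HeightOneSpectrum.eq_of_natCast_mem_of_isPrime_span {ℓ : ℕ} (hℓ : ℓ.Prime)
    (hinert : (Ideal.span {(ℓ : 𝓞 K)}).IsPrime) {v w : HeightOneSpectrum (𝓞 K)}
    (hv : (ℓ : 𝓞 K) ∈ v.asIdeal) (hw : (ℓ : 𝓞 K) ∈ w.asIdeal) : v = w := by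
  have hne : Ideal.span {(ℓ : 𝓞 K)} ≠ ⊥ := by
    rw [Ne, Ideal.span_singleton_eq_bot]; exact_mod_cast hℓ.ne_zero
  have hmax : (Ideal.span {(ℓ : 𝓞 K)}).IsMaximal := hinert.isMaximal hne
  have hv' : v.asIdeal = Ideal.span {(ℓ : 𝓞 K)} :=
    (hmax.eq_of_le v.isPrime.ne_top ((Ideal.span_singleton_le_iff_mem _).mpr hv)).symm
  have hw' : w.asIdeal = Ideal.span {(ℓ : 𝓞 K)} :=
    (hmax.eq_of_le w.isPrime.ne_top ((Ideal.span_singleton_le_iff_mem _).mpr hw)).symm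
  exact HeightOneSpectrum.ext (hv'.trans hw'.symm)

/-- **Membership in `(H_{(𝓕₀)^λ(c)})^{e}` split into its local clauses** (printed §3.3.2/§3.4.1 with
`relaxedAt {v}`): for `x ∈ H¹(K, E[n])` with `τ x = e x`, membership in the `e`-part of the Selmer
group of `(𝓕_⌈Q⌉(c))^{v}` (`selmerF0 … (placesDividing K c) Qcar` relaxed at `v`) follows from: the
Kummer condition at every place not over `c`, not in `Qcar` and not `v`; the stringent condition `𝒮`
at the places of `Qcar` other than `v`; the transverse condition `𝒯` at the places dividing `c` outside
`Qcar ∪ {v}`. Unfolding of `SelmerStructure.modify`. [cite: Jetchev2008, §3.3.2, §3.4.1 (p. 816)] -/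
theorem mem_signPart_relaxedAt_selmerF0 (W : WeierstrassCurve ℚ) (τ : K ≃ₐ[ℚ] K) (n : ℤ) (e : ℤ)
    (𝒯 𝒮 : SelmerStructure ((W.baseChange K).torsionGaloisModule n))
    {c : ℕ} (hc : c ≠ 0) (Qcar : Finset (HeightOneSpectrum (𝓞 K))) (v : HeightOneSpectrum (𝓞 K))
    (x : galoisCohomology ((W.baseChange K).torsionGaloisModule n) 1)
    (hsign : conjAct W τ n x = e • x)
    (hKum : ∀ w : Place K, (∀ ℓ ∈ c.primeFactors, ¬ PlaceOver K w ℓ) → w ≠ Sum.inr v →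
      (∀ q ∈ Qcar, w ≠ Sum.inr q) →
      galoisCohomology.localization ((W.baseChange K).torsionGaloisModule n) w 1 x ∈
        (W.baseChange K).kummerSelmerStructure n w)
    (hstr : ∀ q ∈ Qcar, q ≠ v →
      galoisCohomology.localization ((W.baseChange K).torsionGaloisModule n) (Sum.inr q) 1 x ∈
        𝒮 (Sum.inr q))
    (htr : ∀ w ∈ placesDividing K c, w ∉ Qcar → w ≠ v →
      galoisCohomology.localization ((W.baseChange K).torsionGaloisModule n) (Sum.inr w) 1 x ∈
        𝒯 (Sum.inr w)) :
    x ∈ signPart W K τ n e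
      (((selmerF0 W n 𝒯 𝒮 (placesDividing K c) Qcar).relaxedAt {v}).selmerGroup) := by
  rw [mem_signPart_iff]
  refine ⟨?_, hsign⟩
  rw [SelmerStructure.mem_selmerGroup_iff]
  intro w
  rcases w with w | q
  · -- infinite place: Kummer
    simp only [SelmerStructure.relaxedAt, SelmerStructure.modify_inl, SelmerVocabulary.selmerF0_inl,
      SelmerVocabulary.selmerF_inl]
    exact hKum (Sum.inl w) (fun ℓ _ ⟨_, h, _⟩ ↦ by cases h) (by simp) (fun q _ ↦ by simp)
  · by_cases hqv : q = v
    · subst hqv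
      simp [SelmerStructure.relaxedAt]
    rw [SelmerStructure.relaxedAt, SelmerStructure.modify_inr, if_neg (by simpa using hqv),
      if_neg (Finset.notMem_empty q), if_neg (Finset.notMem_empty q), SelmerVocabulary.selmerF0_inr]
    by_cases hqQ : q ∈ Qcar
    · rw [if_pos hqQ]; exact hstr q hqQ hqv
    rw [if_neg hqQ, SelmerVocabulary.selmerF_inr]
    by_cases hqS : q ∈ placesDividing K c
    · rw [if_pos hqS]; exact htr q hqS hqQ hqv
    rw [if_neg hqS]
    refine hKum (Sum.inr q) (fun ℓ hℓ hP ↦ ?_) (by simpa using hqv) (fun q' hq' h ↦ hqQ ?_)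
    · obtain ⟨w, hw, hvw⟩ := (SelmerVocabulary.exists_placeOver_iff hc (Sum.inr q)).mp ⟨ℓ, hℓ, hP⟩
      cases hvw
      exact hqS hw
    · cases h; exact hq'

end Split

/-- **[J] Thm 5.2 at a core vertex with the kernel bricks plugged in** — see the module docstring for
which inputs are discharged by name (h32, d/hordκ/hκ0, dℓ/hdata, e/hκsign, the Kummer part of hκsel,
hS) and which remain (named print: h44, hCM1, hCM2, h53, hGZ; kernel gaps: htr, hT, hdual_q,
hdual_ℓ, h49str, h49tr, plus the structure parameters 𝒯, 𝒮, Qcar, C'). CONCLUSION: `t ≤ m_∞`.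
[cite: Jetchev2008, Thm. 5.2 (p. 821) and proof] [cite: McCallumLMS1991, §4 Prop. 4.4, §5 (p. 305)]
[cite: GrossLMS1991, Prop. 5.3, Prop. 5.4, Prop. 6.2 (1)] [cite: GrossZagier1986, III (3.1)] -/
theorem tamagawaExponent_le_mInfty_of_kernelInputs
    (h44 : McCallum1991.prop44_localOrder_kolyvaginClass_mul_eq)
    (W : WeierstrassCurve ℚ) [W.IsElliptic] [W.IsGloballyMinimal] [NeZero (W.conductorNorm ℤ)]
    (hcm : ¬ W.HasCM) (K : Type) [Field K] [NumberField K] (hK : IsImaginaryQuadratic K)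
    (hD3 : NumberField.discr K ≠ -3) (hD4 : NumberField.discr K ≠ -4)
    (hH : SatisfiesHeegnerHypothesis (W.conductorNorm ℤ) K)
    (hCM1 : phi_heegnerPointOfConductor_mem_range_map_ringClassField (W.conductorNorm ℤ) W K)
    (hCM2 : exists_generator_ringClassGalOver K)
    (p : ℕ) [Fact p.Prime] (hp2 : p ≠ 2) (htower : ∀ n : ℕ, W.HasSurjectiveModNGaloisRep (p ^ n : ℕ))
    (Dt : ModularParametrizationData W (W.conductorNorm ℤ)) (β : ℤ) (ι : K →+* ℂ)
    [∀ j : ℕ, NumberField (ringClassField K ι j)]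
    (τ : K ≃ₐ[ℚ] K) (hτ : τ ≠ 1)
    -- Gross Prop. 5.3 for the Fricke sign `ε` (cite-only named input)
    (ε : ℤ) (hε : ε = 1 ∨ ε = -1)
    (h53 : ∀ (m : ℕ) (dm : KolyvaginHeegnerData Dt β ι m)
      (τm : ringClassField K ι m ≃ₐ[ℚ] ringClassField K ι m),
      (∀ x : ringClassField K ι m, ((τm x : ringClassField K ι m) : ℂ) = starRingEnd ℂ x) →
      ∃ σ' ∈ ringClassGal ι m, IsOfFinAddOrder
        (pointGalHom W (ringClassField K ι m) τm dm.y -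
          ε • pointGalHom W (ringClassField K ι m) σ' dm.y))
    -- [GZ86 III (3.1)] in the receptacle form, with `n'` prime to `p` (cite-only named input)
    {n' : ℤ} (hcop' : IsCoprime (p : ℤ) n')
    (hGZ : ∀ (m : ℕ) (dm : KolyvaginHeegnerData Dt β ι m)
      (γ : ringClassField K ι m ≃ₐ[ℚ] ringClassField K ι m), γ ∈ ringClassGal ι m →
      ∀ v : HeightOneSpectrum (𝓞 K), ¬ (W.baseChange K).HasGoodReductionAt v →
        n' • pointsMap (W.baseChange K) (v.adicCompletion K)
            (dm.toGeomPoints (pointGalHom W (ringClassField K ι m) γ dm.y)) ∈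
          E0Receptacle (W.baseChange K) v ∧
        ∀ (ℓ : ℕ), ℓ ∈ m.primeFactors → ∀ (dm' : KolyvaginHeegnerData Dt β ι (m / ℓ))
          (hle : ringClassField K ι (m / ℓ) ≤ ringClassField K ι m),
          n' • pointsMap (W.baseChange K) (v.adicCompletion K)
              (dm.toGeomPoints (pointGalHom W (ringClassField K ι m) γ
                (WeierstrassCurve.Affine.Point.map (W' := W)
                  ((RingClassField.inclusion ι hle).restrictScalars ℚ) dm'.y))) ∈
            E0Receptacle (W.baseChange K) v)
    -- the `H63` binder's bookkeeping: `mdiv`, `m`, the level `k`, the core vertex `c`, `m(c) = m_∞`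
    (mdiv m : {c : ℕ // Squarefree c ∧ ∀ ℓ ∈ c.primeFactors,
        Zhang2014.IsKolyvaginPrime (W.conductorNorm ℤ) W K p ℓ} → ℕ∞)
    (hmdiv : ∀ c (u : ℕ), (u : ℕ∞) ≤ mdiv c ↔ ∀ d : KolyvaginHeegnerData Dt β ι c.1,
      ∃ Q : (W.baseChange (ringClassField K ι c.1)).toAffine.Point,
        ((p ^ u : ℕ) : ℤ) • Q = d.derivedPoint)
    (hm : ∀ c, m c = if mdiv c < Zhang2014.levelIndex W p c.1 then mdiv c else ⊤)
    (k : ℕ) (c : {c : ℕ // Squarefree c ∧ ∀ ℓ ∈ c.primeFactors,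
        Zhang2014.IsKolyvaginPrime (W.conductorNorm ℤ) W K p ℓ}) (hk : 1 ≤ k)
    (hcore : IsGlobalCoreVertex W K ι τ p k c.1) (mInf : ℕ) (hmc : m c = mInf)
    (hkM : (k : ℕ∞) + mInf ≤ Zhang2014.levelIndex W p c.1)
    (t : ℕ) (htk : t < k) (hik : mInf < k)
    -- the structures (parameters): local transverse family, stringent family, carrier places, dual module
    (𝒯 𝒮 : SelmerStructure ((W.baseChange K).torsionGaloisModule ((p ^ k : ℕ) : ℤ)))
    (hT : ∀ x : galoisCohomology ((W.baseChange K).torsionGaloisModule ((p ^ k : ℕ) : ℤ)) 1,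
      (∀ w ∈ placesDividing K c.1,
        galoisCohomology.localization ((W.baseChange K).torsionGaloisModule ((p ^ k : ℕ) : ℤ))
          (Sum.inr w) 1 x ∈ 𝒯 (Sum.inr w)) ↔
      ∀ ℓ ∈ c.1.primeFactors, x ∈ transverseKer W K ι ((p ^ k : ℕ) : ℤ) ℓ)
    (hS : ∀ v, 𝒮 v ≤ (W.baseChange K).kummerSelmerStructure ((p ^ k : ℕ) : ℤ) v)
    (Qcar : Finset (HeightOneSpectrum (𝓞 K))) (hQcar : Disjoint Qcar (placesDividing K c.1))
    (e' : ℤ) (he' : e' = ε * (-1) ^ c.1.primeFactors.card)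
    (C' : AddSubgroup (galH1Torsion (W.baseChange K) ((p ^ k : ℕ) : ℤ)))
    (hC : C' ≤ signPart W K τ ((p ^ k : ℕ) : ℤ) (-e') ⊤)
    -- KERNEL GAP (S2/S10): the transverse condition of `c_k(c)` at the primes of `c`
    (htr : ∀ (d : KolyvaginHeegnerData Dt β ι c.1), ∀ ℓ ∈ c.1.primeFactors,
      (d.kolyvaginClass (Fact.out : p.Prime) k :
        galoisCohomology ((W.baseChange K).torsionGaloisModule ((p ^ k : ℕ) : ℤ)) 1) ∈
        transverseKer W K ι ((p ^ k : ℕ) : ℤ) ℓ)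
    -- KERNEL GAP (S1/S3): Thm 5.1 at the carrier + (δ)
    (hdual_q : ∃ (Qg Qg' : Type) (_ : AddCommGroup Qg) (_ : AddCommGroup Qg') (_ : Finite Qg')
      (locq : signPart W K τ ((p ^ k : ℕ) : ℤ) (-e')
        (modifiedSelmerGroup W K ι ((p ^ k : ℕ) : ℤ) c.1) →+ Qg)
      (locq' : C' →+ Qg'),
      (∀ x : C', locq' x = 0 ↔ (x : galH1Torsion (W.baseChange K) ((p ^ k : ℕ) : ℤ)) ∈
        signPart W K τ ((p ^ k : ℕ) : ℤ) (-e') (modifiedSelmerGroup W K ι ((p ^ k : ℕ) : ℤ) c.1)) ∧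
      Nat.card locq.range * Nat.card locq'.range = Nat.card Qg' ∧ IsAddCyclic Qg' ∧ Nat.card Qg' = p ^ t)
    -- KERNEL GAPS (S6/S10): Prop 4.9♯ for the classes at `cℓ` — STRINGENT part at the carrier places
    -- (Jetchev's Prop. 4.9 proper: the x11b3 layer theorem at `v ∣ p` / Lemma 4.3 at `q ≠ p`) and
    -- TRANSVERSE part at the primes of `c`; the sign and Kummer parts are discharged below
    (h49str : ∀ (ℓ : ℕ), Zhang2014.IsKolyvaginPrime (W.conductorNorm ℤ) W K p ℓ →
      k ≤ Zhang2014.kolyvaginIndex W p ℓ → ℓ ∉ c.1.primeFactors →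
      ∀ (d' : KolyvaginHeegnerData Dt β ι (c.1 * ℓ)), ∀ q ∈ Qcar,
      galoisCohomology.localization ((W.baseChange K).torsionGaloisModule ((p ^ k : ℕ) : ℤ))
          (Sum.inr q) 1 (d'.kolyvaginClass (Fact.out : p.Prime) k) ∈ 𝒮 (Sum.inr q))
    (h49tr : ∀ (ℓ : ℕ), Zhang2014.IsKolyvaginPrime (W.conductorNorm ℤ) W K p ℓ →
      k ≤ Zhang2014.kolyvaginIndex W p ℓ → ℓ ∉ c.1.primeFactors →
      ∀ (d' : KolyvaginHeegnerData Dt β ι (c.1 * ℓ)), ∀ w ∈ placesDividing K c.1,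
      galoisCohomology.localization ((W.baseChange K).torsionGaloisModule ((p ^ k : ℕ) : ℤ))
          (Sum.inr w) 1 (d'.kolyvaginClass (Fact.out : p.Prime) k) ∈ 𝒯 (Sum.inr w))
    -- KERNEL GAP (S1): Thm 5.1 / Lemma 5.2 (iii) at `λ`
    (hdual_ℓ : ∀ (ℓ : ℕ), Zhang2014.IsKolyvaginPrime (W.conductorNorm ℤ) W K p ℓ →
      k ≤ Zhang2014.kolyvaginIndex W p ℓ → ℓ ∉ c.1.primeFactors →
      ∀ (v : HeightOneSpectrum (𝓞 K)), (ℓ : 𝓞 K) ∈ v.asIdeal →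
      ∃ (Sg : Type) (_ : AddCommGroup Sg)
        (sing : signPart W K τ ((p ^ k : ℕ) : ℤ) (-e')
          (((selmerF0 W ((p ^ k : ℕ) : ℤ) 𝒯 𝒮 (placesDividing K c.1) Qcar).relaxedAt {v}).selmerGroup) →+ Sg),
        (∀ x, sing x = 0 ↔ (x : galoisCohomology ((W.baseChange K).torsionGaloisModule ((p ^ k : ℕ) : ℤ)) 1) ∈
          signPart W K τ ((p ^ k : ℕ) : ℤ) (-e')
            ((selmerF0 W ((p ^ k : ℕ) : ℤ) 𝒯 𝒮 (placesDividing K c.1) Qcar).selmerGroup)) ∧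
        Nat.card sing.range *
          Nat.card (C'.map (galoisCohomology.localization
            ((W.baseChange K).torsionGaloisModule ((p ^ k : ℕ) : ℤ)) (Sum.inr v) 1 :
              galH1Torsion (W.baseChange K) ((p ^ k : ℕ) : ℤ) →+ _)) = p ^ k) :
    t ≤ mInf := by
  have hp : p.Prime := Fact.out
  have hρ : W.HasSurjectiveModNGaloisRep p := by simpa using htower 1
  have hD : NumberField.discr K < -4 := KolyvaginAssembly.discr_lt_neg_four hK ⟨hD3, hD4⟩
  -- level bookkeeping: `k ≤ M(c)`, hence `k ≤ M(ℓ)` at the primes of `c`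
  have hkc : (k : ℕ∞) ≤ Zhang2014.levelIndex W p c.1 := le_trans le_self_add hkM
  have hcK : ∀ ℓ ∈ c.1.primeFactors, Zhang2014.IsKolyvaginPrime (W.conductorNorm ℤ) W K p ℓ ∧
      k ≤ Zhang2014.kolyvaginIndex W p ℓ := fun ℓ hℓ ↦
    ⟨c.2.2 ℓ hℓ, Zhang2014.natCast_le_levelIndex_iff.mp hkc ℓ hℓ⟩
  -- (S7) the datum `d` of conductor `c` with `p^{m_∞} ∥ P_c`, `ord c_k(c) = p^{k − m_∞}`, `c_k(c) ≠ 0`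
  obtain ⟨d, -, -, hordκ, hκ0⟩ := exists_datum_addOrderOf_kolyvaginClass_of_m_eq hCM1 hCM2 hK hD3 hD4
    hH hp2 hρ Dt β ι mdiv m hmdiv hm c mInf k hmc hik hkc
  -- (sign) Gross Prop 5.4: `τ c_k(c) = e' c_k(c)`, `e' = ε(−1)^r ∈ {±1}`
  obtain ⟨he, hκsign⟩ := exists_sign_conjAct_kolyvaginClass_of_prop53 hCM1 hCM2 hK hD3 hD4 hH hp2 hρ
    τ hτ Dt β ι ε hε h53 c.2.1 hk hcK d
  rw [← he'] at he hκsign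
  -- (Selmer membership) Kummer part by Gross 6.2 (1) mod GZ31, transverse part = the gap `htr`
  have hκsel : d.kolyvaginClass hp k ∈ modifiedSelmerGroup W K ι ((p ^ k : ℕ) : ℤ) c.1 :=
    (mem_modifiedSelmerGroup_iff W K ι ((p ^ k : ℕ) : ℤ) c.1 _).mpr
      ⟨fun v hv ↦ localization_kolyvaginClass_mem_kummerSelmerStructure_of_GZ31 hCM1 hCM2 hK hD3
        hD4 hH hp2 hρ Dt β ι hcop' hGZ c.2.1 hcK d v hv, htr d⟩
  -- (compatible data at `cℓ`) from the CM fact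
  obtain ⟨dℓ, hdℓ⟩ := exists_compatible_data_of_grossCM hCM1 hK hD hH p Dt β ι c.2.1
    (fun ℓ hℓ ↦ c.2.2 ℓ hℓ) d
  -- (Prop 4.9♯ at `cℓ`) sign and Kummer parts discharged; stringent + transverse = the gaps
  have hc0 : c.1 ≠ 0 := c.2.1.ne_zero
  have h49 : ∀ (ℓ : ℕ) (h1 : Zhang2014.IsKolyvaginPrime (W.conductorNorm ℤ) W K p ℓ)
      (h2 : k ≤ Zhang2014.kolyvaginIndex W p ℓ) (h3 : ℓ ∉ c.1.primeFactors)
      (v : HeightOneSpectrum (𝓞 K)), (ℓ : 𝓞 K) ∈ v.asIdeal →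
      (dℓ ℓ h1 h3).kolyvaginClass hp k ∈
        signPart W K τ ((p ^ k : ℕ) : ℤ) (-e')
          (((selmerF0 W ((p ^ k : ℕ) : ℤ) 𝒯 𝒮 (placesDividing K c.1) Qcar).relaxedAt {v}).selmerGroup) := by
    intro ℓ h1 h2 h3 v hv
    have hl : ℓ.Prime := h1.1
    have hlc : ¬ ℓ ∣ c.1 := fun h ↦ h3 (Nat.mem_primeFactors.mpr ⟨hl, h, hc0⟩)
    have hcl : Squarefree (c.1 * ℓ) :=
      (Nat.squarefree_mul ((Nat.Prime.coprime_iff_not_dvd hl).mpr hlc).symm).mpr ⟨c.2.1, hl.squarefree⟩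
    have hpf : (c.1 * ℓ).primeFactors = c.1.primeFactors ∪ {ℓ} := by
      rw [Nat.primeFactors_mul hc0 hl.ne_zero, hl.primeFactors]
    have hcKℓ : ∀ l' ∈ (c.1 * ℓ).primeFactors, Zhang2014.IsKolyvaginPrime (W.conductorNorm ℤ) W K p l' ∧
        k ≤ Zhang2014.kolyvaginIndex W p l' := by
      intro l' hl'
      rw [hpf, Finset.mem_union, Finset.mem_singleton] at hl'
      rcases hl' with h | rfl
      · exact hcK l' h
      · exact ⟨h1, h2⟩
    -- the sign at `cℓ`: `ε(−1)^{r+1} = −e'`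
    obtain ⟨-, hsignℓ⟩ := exists_sign_conjAct_kolyvaginClass_of_prop53 hCM1 hCM2 hK hD3 hD4 hH hp2 hρ
      τ hτ Dt β ι ε hε h53 hcl hk hcKℓ (dℓ ℓ h1 h3)
    have hcard : (c.1 * ℓ).primeFactors.card = c.1.primeFactors.card + 1 := by
      rw [hpf, Finset.card_union_of_disjoint (Finset.disjoint_singleton_right.mpr h3),
        Finset.card_singleton]
    rw [hcard, pow_succ, ← mul_assoc, ← he', mul_neg_one] at hsignℓ
    refine mem_signPart_relaxedAt_selmerF0 W τ _ (-e') 𝒯 𝒮 hc0 Qcar v _ hsignℓ ?_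
      (fun q hq _ ↦ h49str ℓ h1 h2 h3 (dℓ ℓ h1 h3) q hq)
      (fun w hw _ _ ↦ h49tr ℓ h1 h2 h3 (dℓ ℓ h1 h3) w hw)
    -- the Kummer part: Gross 6.2 (1) mod GZ31 at level `cℓ`, at every place not over `cℓ`
    intro w hwc hwv _
    refine localization_kolyvaginClass_mem_kummerSelmerStructure_of_GZ31 hCM1 hCM2 hK hD3 hD4 hH hp2
      hρ Dt β ι hcop' hGZ hcl hcKℓ (dℓ ℓ h1 h3) w fun l' hl' hP ↦ ?_
    rw [hpf, Finset.mem_union, Finset.mem_singleton] at hl'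
    rcases hl' with h | rfl
    · exact hwc l' h hP
    · obtain ⟨q, rfl, hq⟩ := hP
      exact hwv (congrArg Sum.inr
        (HeightOneSpectrum.eq_of_natCast_mem_of_isPrime_span h1.1 h1.2.2.2.2.1 hq hv))
  -- assemble through the row theorem (h32 = Cor 3.2 PROVED)
  exact tamagawaExponent_le_mInfty_of_rowData McCallum1991.cor32_eigenclasses_infinite_primes_localOrder_holds
    h44 W hcm K hK hD3 hD4 hH p hp2 htower Dt β ι τ hτ k t mInf hk htk hik c.1 c.2.1 hcK hcore e' he d
    hκsel hκsign hκ0 hordκ 𝒯 𝒮 hT hS Qcar hQcar C' hC hdual_q (fun ℓ h1 _ h3 ↦ dℓ ℓ h1 h3)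
    (fun ℓ h1 _ h3 ↦ hdℓ ℓ h1 h3) h49 hdual_ℓ

end Summit.BirchSwinnertonDyer.Rank1Residual.JET

end
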